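import Literature.Geometry.Lorentzian.CoordConstraintAdjoint
import Literature.Geometry.Lorentzian.CoordKIDEquations
import Literature.Geometry.Lorentzian.CoordFormCauchySchwarz
import HarnessLib

/-!
# Recovering `S(Y)` and `Hess N` from the rows of the KID operator (Chruściel–Delay 2003, §2, §5)

Topic `Literature/Geometry/Lorentzian`, coordinate tensor calculus `MetricCoord`: pointwise linear
algebra at ONE point `x` of an open set `V` carrying metric components `G` (`IsMetricOn G V`).
Everything here is PROVED; no definition and no statement of `Prop` type is introduced.

The formal adjoint `P*` of the linearised constraint map (Chruściel–Delay, Mém. SMF 94 (2003), §2)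
has, in the tree's normalisation, the `κ`-row `adjHamK N + adjMomKS Y = −2N K + 2N (tr K) G − S(Y)
+ (div Y) G` (`S(Y) = sym G(∇Y·,·)`) and the `γ`-row `adjHamG N + adjMomGS Y = −(ΔN) G + Hess N
− N Ric + 2N K∘K − 2N (tr K) K + adjMomGS Y`. The principal parts `S(Y)` and `Hess N` — the
quantities controlled near the boundary by (5.12) (`CoordWeightedKornBoundary.lean`) and by the
weighted Hessian estimate (`CoordWeightedHessianBoundary.lean`) — are recovered from the rows by
removing traces (`dim E ≠ 1`):

* `normSqAt_add_le_of_symm`, `normSqAt_add_three_le_of_symm`, `mtrAt_sq_le_normSqAt` — `|α+β|² ≤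
  2|α|² + 2|β|²`, `|α+β+γ|² ≤ 3(|α|²+|β|²+|γ|²)`, `(tr_G β)² ≤ n|β|²` at a positive definite point;
* **`kidRowK_recovery`** — `S(Y) + ½(div Y) G = −R_K + (3/(2(n−1))) (tr_G R_K) G − N (tr K G + 2K)`
  with `R_K = adjHamK N + adjMomKS Y`;
* **`kidRowG_recovery`** — `Hess N = R_G − (n−1)⁻¹(tr_G R_G) G + N Z − (M − (n−1)⁻¹(tr_G M) G)`
  with `R_G = adjHamG N + adjMomGS Y`, `M = adjMomGS Y`,
  `Z = Ric − 2K∘K + 2(tr K)K + (n−1)⁻¹(−scal + 2 tr(K∘K) − 2(tr K)²) G`.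

## References

* P. T. Chruściel, E. Delay, Mém. Soc. Math. Fr. 94 (2003), §2 (the operator `P*`), proof of
  Thm. 5.9. [ChruscielDelay2003]
* B. O'Neill, *Semi-Riemannian geometry*, 1983, Ch. 3, pp. 60–61. [ONeill1983]
-/

noncomputable section

set_option maxSynthPendingDepth 3

open Set Filter Module Function

namespace Literature.Geometry.Lorentzian

namespace MetricCoord

variable {E : Type*} [NormedAddCommGroup E] [NormedSpace ℝ E] [FiniteDimensional ℝ E]
  {G : E → E →L[ℝ] E →L[ℝ] ℝ} {V : Set E} {x : E}
  {K : E → E →L[ℝ] E →L[ℝ] ℝ} {N : E → ℝ} {Y : E → E}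

/-! ### Norm inequalities at a positive definite point -/

/-- **`0 ≤ |β|²`** at a symmetric positive definite point (`|β|² = Σ β(e_i,e_j)²` in an orthonormal
frame; no symmetry of `β` needed). [cite: ONeill1983, Ch. 3, pp. 60–61] -/
theorem normSqAt_nonneg_of_pos (hG : IsMetricOn G V) (hx : x ∈ V)
    (hpos : ∀ v : E, v ≠ 0 → 0 < G x v v) (β : E →L[ℝ] E →L[ℝ] ℝ) : 0 ≤ normSqAt G x β := by
  have hi := hG.isInvertible x hx
  have hs := hG.symm x hx
  obtain ⟨e, he⟩ := exists_orthonormal_basis hs hpos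
  rw [normSqAt_eq_sum_frame e he hi hs]
  exact Finset.sum_nonneg fun i _ ↦ Finset.sum_nonneg fun j _ ↦ sq_nonneg _

/-- **`|α + β|² ≤ 2|α|² + 2|β|²`** at a symmetric positive definite point.
[cite: ONeill1983, Ch. 3, pp. 60–61] -/
theorem normSqAt_add_le (hG : IsMetricOn G V) (hx : x ∈ V)
    (hpos : ∀ v : E, v ≠ 0 → 0 < G x v v) (α β : E →L[ℝ] E →L[ℝ] ℝ) :
    normSqAt G x (α + β) ≤ 2 * normSqAt G x α + 2 * normSqAt G x β := by
  have hi := hG.isInvertible x hx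
  have hs := hG.symm x hx
  obtain ⟨e, he⟩ := exists_orthonormal_basis hs hpos
  rw [normSqAt_eq_sum_frame e he hi hs, normSqAt_eq_sum_frame e he hi hs,
    normSqAt_eq_sum_frame e he hi hs, Finset.mul_sum, Finset.mul_sum, ← Finset.sum_add_distrib]
  refine Finset.sum_le_sum fun i _ ↦ ?_
  rw [Finset.mul_sum, Finset.mul_sum, ← Finset.sum_add_distrib]
  refine Finset.sum_le_sum fun j _ ↦ ?_
  simp only [_root_.add_apply]
  nlinarith [sq_nonneg (α (e i) (e j) - β (e i) (e j))]

/-- **`|α + β + γ|² ≤ 3(|α|² + |β|² + |γ|²)`** at a symmetric positive definite point.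
[cite: ONeill1983, Ch. 3, pp. 60–61] -/
theorem normSqAt_add_three_le (hG : IsMetricOn G V) (hx : x ∈ V)
    (hpos : ∀ v : E, v ≠ 0 → 0 < G x v v) (α β γ : E →L[ℝ] E →L[ℝ] ℝ) :
    normSqAt G x (α + β + γ) ≤ 3 * (normSqAt G x α + normSqAt G x β + normSqAt G x γ) := by
  have hi := hG.isInvertible x hx
  have hs := hG.symm x hx
  obtain ⟨e, he⟩ := exists_orthonormal_basis hs hpos
  rw [normSqAt_eq_sum_frame e he hi hs, normSqAt_eq_sum_frame e he hi hs,
    normSqAt_eq_sum_frame e he hi hs, normSqAt_eq_sum_frame e he hi hs, ← Finset.sum_add_distrib,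
    ← Finset.sum_add_distrib, Finset.mul_sum]
  refine Finset.sum_le_sum fun i _ ↦ ?_
  rw [← Finset.sum_add_distrib, ← Finset.sum_add_distrib, Finset.mul_sum]
  refine Finset.sum_le_sum fun j _ ↦ ?_
  simp only [_root_.add_apply]
  nlinarith [sq_nonneg (α (e i) (e j) - β (e i) (e j)), sq_nonneg (α (e i) (e j) - γ (e i) (e j)),
    sq_nonneg (β (e i) (e j) - γ (e i) (e j))]

/-- **`(tr_G β)² ≤ n |β|²`** at a symmetric positive definite point (`tr_G β = Σ β(e_i,e_i)` and
Cauchy–Schwarz). [cite: ONeill1983, Ch. 3, pp. 60–61] -/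
theorem mtrAt_sq_le_normSqAt (hG : IsMetricOn G V) (hx : x ∈ V)
    (hpos : ∀ v : E, v ≠ 0 → 0 < G x v v) (β : E →L[ℝ] E →L[ℝ] ℝ) :
    mtrAt G x β ^ 2 ≤ finrank ℝ E * normSqAt G x β := by
  have hi := hG.isInvertible x hx
  have hs := hG.symm x hx
  obtain ⟨e, he⟩ := exists_orthonormal_basis hs hpos
  rw [mtrAt_eq_sum_frame e he hi, normSqAt_eq_sum_frame e he hi hs]
  have h1 : (∑ i, β (e i) (e i)) ^ 2 ≤ (∑ _i : Fin (finrank ℝ E), (1 : ℝ) ^ 2) * ∑ i, β (e i) (e i) ^ 2 := by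
    have h := Finset.sum_mul_sq_le_sq_mul_sq Finset.univ (fun _ : Fin (finrank ℝ E) ↦ (1 : ℝ))
      (fun i ↦ β (e i) (e i))
    simpa only [one_mul] using h
  have h2 : ∑ i, β (e i) (e i) ^ 2 ≤ ∑ i, ∑ j, β (e i) (e j) ^ 2 :=
    Finset.sum_le_sum fun i _ ↦ Finset.single_le_sum (f := fun j ↦ β (e i) (e j) ^ 2)
      (fun j _ ↦ sq_nonneg _) (Finset.mem_univ i)
  have hn : (∑ _i : Fin (finrank ℝ E), (1 : ℝ) ^ 2) = finrank ℝ E := by simp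
  rw [hn] at h1
  exact h1.trans (mul_le_mul_of_nonneg_left h2 (Nat.cast_nonneg _))

/-! ### The `κ`-row -/

/-- **Recovering `S(Y)` from the `κ`-row**: with `R_K = adjHamK N + adjMomKS Y`
(`= −2N K + 2N (tr K) G − S(Y) + (div Y) G`, `tr_G R_K = (n−1)(2N tr K + div Y)`), for
`n = dim E ≠ 1`,
`S(Y) + ½ (div Y) G = −R_K + (3/(2(n−1))) (tr_G R_K) G − N ((tr K) G + 2K)`.
[cite: ChruscielDelay2003, §2] -/
theorem kidRowK_recovery (hG : IsMetricOn G V) (hx : x ∈ V) (hn : finrank ℝ E ≠ 1) :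
    symAt ((G x).comp (covDAt G Y x)) + (2⁻¹ * divAt G Y x) • G x =
      -(adjHamK G K N x + adjMomKS G Y x)
        + (3 / (2 * ((finrank ℝ E : ℝ) - 1)) * mtrAt G x (adjHamK G K N x + adjMomKS G Y x)) • G x
        - N x • (mtrAt G x (K x) • G x + (2 : ℝ) • K x) := by
  have hi := hG.isInvertible x hx
  have hs := hG.symm x hx
  have hn' : (finrank ℝ E : ℝ) - 1 ≠ 0 := by
    rw [sub_ne_zero]; exact_mod_cast hn
  have htr : mtrAt G x (adjHamK G K N x + adjMomKS G Y x) =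
      ((finrank ℝ E : ℝ) - 1) * (2 * N x * mtrAt G x (K x) + divAt G Y x) := by
    simp only [adjHamK, adjMomKS, mtrAt_add, mtrAt_neg, mtrAt_smul, mtrAt_metric hi hs,
      mtrAt_symAt hi hs, mtrAt_metric_comp_covDAt hi]
    ring
  rw [htr]
  ext v w
  simp only [adjHamK, adjMomKS, _root_.add_apply, _root_.sub_apply, _root_.neg_apply,
    _root_.smul_apply, smul_eq_mul]
  field_simp
  ring

/-! ### The `γ`-row -/

/-- **Recovering `Hess N` from the `γ`-row**: with `R_G = adjHamG N + adjMomGS Y`, `M = adjMomGS Y`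
and `Z = Ric − 2K∘K + 2(tr K)K + (n−1)⁻¹(−scal + 2 tr(K∘K) − 2(tr K)²) G`
(`(K∘K)(v,w) = K(♯K(v,·),w)`), for `n = dim E ≠ 1`,
`Hess N = R_G − (n−1)⁻¹ (tr_G R_G) G + N Z − (M − (n−1)⁻¹ (tr_G M) G)`
(`tr_G R_G = −(n−1)ΔN − N scal + 2N tr(K∘K) − 2N(tr K)² + tr_G M`).
[cite: ChruscielDelay2003, §2] -/
theorem kidRowG_recovery (hG : IsMetricOn G V) (hx : x ∈ V) (hn : finrank ℝ E ≠ 1) :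
    hessAt G N x =
      (adjHamG G K N x + adjMomGS G K Y x)
        - (((finrank ℝ E : ℝ) - 1)⁻¹ * mtrAt G x (adjHamG G K N x + adjMomGS G K Y x)) • G x
        + N x • (ricAt G x - (2 : ℝ) • (K x).comp ((sharpAt G x).comp (K x))
            + (2 * mtrAt G x (K x)) • K x
            + (((finrank ℝ E : ℝ) - 1)⁻¹ * (-scalAt G x
                + 2 * mtrAt G x ((K x).comp ((sharpAt G x).comp (K x)))
                - 2 * mtrAt G x (K x) ^ 2)) • G x)
        - (adjMomGS G K Y x
            - (((finrank ℝ E : ℝ) - 1)⁻¹ * mtrAt G x (adjMomGS G K Y x)) • G x) := by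
  have hi := hG.isInvertible x hx
  have hs := hG.symm x hx
  have hn' : (finrank ℝ E : ℝ) - 1 ≠ 0 := by
    rw [sub_ne_zero]; exact_mod_cast hn
  have htr : mtrAt G x (adjHamG G K N x + adjMomGS G K Y x) =
      -(((finrank ℝ E : ℝ) - 1) * lapAt G N x) - N x * scalAt G x
        + 2 * N x * mtrAt G x ((K x).comp ((sharpAt G x).comp (K x)))
        - 2 * N x * mtrAt G x (K x) ^ 2 + mtrAt G x (adjMomGS G K Y x) := by
    simp only [adjHamG, adjScalAt, mtrAt_add, mtrAt_sub, mtrAt_smul, mtrAt_metric hi hs,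
      lapAt, scalAt]
    ring
  rw [htr]
  ext v w
  simp only [adjHamG, adjScalAt, lapAt, _root_.add_apply, _root_.sub_apply,
    _root_.smul_apply, smul_eq_mul]
  field_simp
  ring

/-! ### The bounds -/

/-- **`|S(Y) + ½(div Y)G|² ≤ C_n |R_K|² + 3N²|(tr K)G + 2K|²** with `R_K = adjHamK N + adjMomKS Y`
and `C_n = 3 + 27n³/(4(n−1)²)`, at a positive definite point (`n = dim E ≠ 1`).
[cite: ChruscielDelay2003, §2, Thm. 5.9 (proof)] -/
theorem normSqAt_kidT_le (hG : IsMetricOn G V) (hx : x ∈ V) (hpos : ∀ v : E, v ≠ 0 → 0 < G x v v)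
    (hn : finrank ℝ E ≠ 1) :
    normSqAt G x (symAt ((G x).comp (covDAt G Y x)) + (2⁻¹ * divAt G Y x) • G x) ≤
      (3 + 3 * (3 / (2 * ((finrank ℝ E : ℝ) - 1))) ^ 2 * (finrank ℝ E : ℝ) ^ 2)
          * normSqAt G x (adjHamK G K N x + adjMomKS G Y x)
        + 3 * N x ^ 2 * normSqAt G x (mtrAt G x (K x) • G x + (2 : ℝ) • K x) := by
  have hi := hG.isInvertible x hx
  have hs := hG.symm x hx
  set R := adjHamK G K N x + adjMomKS G Y x with hR
  set c : ℝ := 3 / (2 * ((finrank ℝ E : ℝ) - 1)) with hc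
  set W := mtrAt G x (K x) • G x + (2 : ℝ) • K x with hW
  rw [kidRowK_recovery (K := K) (N := N) hG hx hn, ← hR]
  have h3 := normSqAt_add_three_le hG hx hpos (-R) ((c * mtrAt G x R) • G x) (-(N x • W))
  have hneg : ∀ β : E →L[ℝ] E →L[ℝ] ℝ, normSqAt G x (-β) = normSqAt G x β := fun β ↦ by
    rw [show -β = (-1 : ℝ) • β by simp, normSqAt_smul]; ring
  rw [sub_eq_add_neg] 
  refine h3.trans ?_
  rw [hneg, hneg, normSqAt_smul, normSqAt_smul, normSqAt_metric hi hs]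
  have htr := mtrAt_sq_le_normSqAt hG hx hpos R
  have hR0 := normSqAt_nonneg_of_pos hG hx hpos R
  have hn0 : (0 : ℝ) ≤ finrank ℝ E := Nat.cast_nonneg _
  nlinarith [mul_le_mul_of_nonneg_left htr (by positivity : (0 : ℝ) ≤ c ^ 2 * finrank ℝ E)]

/-- **`|Hess N|² ≤ 6(1 + n²/(n−1)²)|R_G|² + 3N²|Z|² + 6(1 + n²/(n−1)²)|M|²`** with
`R_G = adjHamG N + adjMomGS Y`, `M = adjMomGS Y` and `Z` as in `kidRowG_recovery`, at a positive
definite point (`n = dim E ≠ 1`). [cite: ChruscielDelay2003, §2, Thm. 5.9 (proof)] -/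
theorem normSqAt_hessAt_le_of_rows (hG : IsMetricOn G V) (hx : x ∈ V)
    (hpos : ∀ v : E, v ≠ 0 → 0 < G x v v) (hn : finrank ℝ E ≠ 1) :
    normSqAt G x (hessAt G N x) ≤
      6 * (1 + (((finrank ℝ E : ℝ) - 1)⁻¹) ^ 2 * (finrank ℝ E : ℝ) ^ 2)
          * normSqAt G x (adjHamG G K N x + adjMomGS G K Y x)
        + 3 * N x ^ 2 * normSqAt G x (ricAt G x - (2 : ℝ) • (K x).comp ((sharpAt G x).comp (K x))
            + (2 * mtrAt G x (K x)) • K x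
            + (((finrank ℝ E : ℝ) - 1)⁻¹ * (-scalAt G x
                + 2 * mtrAt G x ((K x).comp ((sharpAt G x).comp (K x)))
                - 2 * mtrAt G x (K x) ^ 2)) • G x)
        + 6 * (1 + (((finrank ℝ E : ℝ) - 1)⁻¹) ^ 2 * (finrank ℝ E : ℝ) ^ 2)
          * normSqAt G x (adjMomGS G K Y x) := by
  have hi := hG.isInvertible x hx
  have hs := hG.symm x hx
  set R := adjHamG G K N x + adjMomGS G K Y x with hR
  set c : ℝ := ((finrank ℝ E : ℝ) - 1)⁻¹ with hc
  set M := adjMomGS G K Y x with hM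
  set Z := ricAt G x - (2 : ℝ) • (K x).comp ((sharpAt G x).comp (K x))
      + (2 * mtrAt G x (K x)) • K x
      + (c * (-scalAt G x + 2 * mtrAt G x ((K x).comp ((sharpAt G x).comp (K x)))
          - 2 * mtrAt G x (K x) ^ 2)) • G x with hZ
  rw [kidRowG_recovery (K := K) (Y := Y) hG hx hn, ← hR, ← hM]
  have hneg : ∀ β : E →L[ℝ] E →L[ℝ] ℝ, normSqAt G x (-β) = normSqAt G x β := fun β ↦ by
    rw [show -β = (-1 : ℝ) • β by simp, normSqAt_smul]; ring
  -- group as `(R − c trR G) + N Z + (−(M − c trM G))`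
  have hsplit : R - (c * mtrAt G x R) • G x + N x • Z - (M - (c * mtrAt G x M) • G x) =
      (R + (-(c * mtrAt G x R)) • G x) + N x • Z + (-(M + (-(c * mtrAt G x M)) • G x)) := by
    ext v w
    simp only [_root_.add_apply, _root_.sub_apply, _root_.neg_apply, _root_.smul_apply, smul_eq_mul]
    ring
  rw [hsplit]
  refine (normSqAt_add_three_le hG hx hpos _ _ _).trans ?_
  rw [hneg, normSqAt_smul]
  have h1 := normSqAt_add_le hG hx hpos R ((-(c * mtrAt G x R)) • G x)
  have h2 := normSqAt_add_le hG hx hpos M ((-(c * mtrAt G x M)) • G x)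
  rw [normSqAt_smul, normSqAt_metric hi hs] at h1 h2
  have htrR := mtrAt_sq_le_normSqAt hG hx hpos R
  have htrM := mtrAt_sq_le_normSqAt hG hx hpos M
  have hR0 := normSqAt_nonneg_of_pos hG hx hpos R
  have hM0 := normSqAt_nonneg_of_pos hG hx hpos M
  have hZ0 := normSqAt_nonneg_of_pos hG hx hpos Z
  have hn0 : (0 : ℝ) ≤ finrank ℝ E := Nat.cast_nonneg _
  have hcn : 0 ≤ c ^ 2 * (finrank ℝ E : ℝ) := by positivity
  nlinarith [mul_le_mul_of_nonneg_left htrR hcn, mul_le_mul_of_nonneg_left htrM hcn,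
    sq_nonneg (N x)]

end MetricCoord

end Literature.Geometry.Lorentzian

end
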